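import Literature.AlgebraicGeometry.Frobenioids.KummerDualityNaturality
import Literature.AlgebraicGeometry.Frobenioids.KummerThetaBijective
import Literature.AlgebraicGeometry.Frobenioids.KummerCupDualTransport
import HarnessLib

/-!
# Frobenioids II, Def. 2.2 (ii) / Thm. 2.4 (i): the cup-product duality isomorphism of a Definition 2.2
# context and its naturality — assembly (row L1-γ₁)

Mochizuki, *The geometry of Frobenioids II*, Kyushu J. Math. **62** (2008), §2, Def. 2.2 (ii) p. 18 and
Thm. 2.4 (i) p. 19 [cite: MochizukiFrdII2008, Def 2.2 p.18]. One entry point for the consumer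
(abc-iut-L1-d4's discharge of Thm. 2.4 (i), `PadicKummerSettingProofs` / `PadicKummerIsoKummerMaps`, which
took `Kummer.DualityIso` data and the "(γ₁)" naturality as hypotheses):

* **`Def22Context.dualityIsoOfLocalDuality X N e h hH : Kummer.DualityIso N X.O X.HA X.qHA`** — for a
  Definition 2.2 context `X` with `H_A` finite, an isomorphism `e : F_N(A) ≃+ ℤ/N` (FrdII p. 18; at the
  local-field binding abc-iut-L1-t7's `nonempty_fn_equiv_zmod_ofLocalField`), `h : IsNHSaturated X N`
  (Def. 2.2 (ii)) and `hH` = local Tate duality for the (profinite) group `H` in adjoint form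
  (`Bijective (Kummer.cupDualH …)`; [NSW 7.2.6]): the duality isomorphism
  `H¹(H_A, μ_N(A)) ⥲ H_A^ab ⊗ F_N(A)` CONSTRUCTED from the cup product (`Kummer.dualityIsoOfCupProduct`,
  with `hθ` from `Kummer.thetaHom_bijective` and `hcup` from `Kummer.cupDual_bijective_of_isCohSaturated`);
* **`Def22Context.Iso.recTargetMap_dualityIsoOfLocalDuality`** — Thm. 2.4 (i) "(γ₁)": for an isomorphism
  `e : X₁ ≅ X₂` of contexts, `recTargetMap ∘ ι₁ = ι₂ ∘ isoH1` for these isomorphisms (PROVED,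
  `recTargetMap_dualityIsoOfCupProduct`).

The one remaining named input is `hH` (see `KummerCupDualTransport.lean` for its reduction to the trunk's
`localDuality_bijective` at `Def22Context.ofLocalField`). Nothing here concerns [IUTchIII]; universe `0`.
-/

noncomputable section

namespace Literature.AlgebraicGeometry.Frobenioids

namespace PadicKummer

namespace Def22Context

open Kummer

variable (X : Def22Context) (N : ℕ) [NeZero N] [Finite X.HA] [LocallyCompactSpace X.H]

/-- **The duality isomorphism `H¹(H_A, μ_N(A)) ⥲ H_A^ab ⊗ F_N(A)` of a Definition 2.2 context from local
duality for `H`** (FrdII p. 18: local Tate duality for `H` "together with condition (c)"): the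
cup-product construction `Kummer.dualityIsoOfCupProduct` with both bijectivity inputs supplied —
`θ` bijective from `H_A` finite and `F_N(A) ≅ ℤ/N`, `cupDual` bijective from (c) and `hH`.
[cite: MochizukiFrdII2008, Def 2.2 p.18] -/
def dualityIsoOfLocalDuality (e : FN X N ≃+ ZMod N) (h : IsNHSaturated X N)
    (hH : Function.Bijective (cupDualH N X.O X.HA X.qHA)) : Kummer.DualityIso N X.O X.HA X.qHA :=
  dualityIsoOfCupProduct N X.O X.HA X.qHA (thetaHom_bijective N X.O X.HA X.qHA e)
    (cupDual_bijective_of_isCohSaturated h.cohSaturated hH)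

/-- Its characterisation: `θ (ι c) = cupDual (h1MuEquiv c)` (the isomorphism IS the cup product read
through `θ`). [cite: MochizukiFrdII2008, Def 2.2 p.18] -/
theorem thetaHom_dualityIsoOfLocalDuality (e : FN X N ≃+ ZMod N) (h : IsNHSaturated X N)
    (hH : Function.Bijective (cupDualH N X.O X.HA X.qHA))
    (c : groupCohomology.H1 (Rep.ofMulDistribMulAction X.HA (Mu N X.O))) :
    thetaHom N X.O X.HA X.qHA ((X.dualityIsoOfLocalDuality N e h hH).toAddEquiv c) =
      cupDual N X.O X.HA X.qHA (h1MuEquiv N X.O X.HA c) :=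
  thetaHom_dualityIsoOfCupProduct N X.O X.HA X.qHA _ _ c

variable {X N} {X₁ X₂ : Def22Context} [Finite X₁.HA] [LocallyCompactSpace X₁.H]
  [Finite X₂.HA] [LocallyCompactSpace X₂.H]

/-- **Theorem 2.4 (i), "(γ₁)" for the duality isomorphisms from local duality**: along every isomorphism
of Definition 2.2 contexts, `recTargetMap ∘ ι₁ = ι₂ ∘ isoH1` — abc-iut-L1-d4's naturality hypothesis,
PROVED for `dualityIsoOfLocalDuality`. [cite: MochizukiFrdII2008, Thm 2.4 (i) p.19] -/
theorem Iso.recTargetMap_dualityIsoOfLocalDuality (f : Def22Context.Iso X₁ X₂)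
    (e₁ : FN X₁ N ≃+ ZMod N) (h₁ : IsNHSaturated X₁ N)
    (hH₁ : Function.Bijective (cupDualH N X₁.O X₁.HA X₁.qHA))
    (e₂ : FN X₂ N ≃+ ZMod N) (h₂ : IsNHSaturated X₂ N)
    (hH₂ : Function.Bijective (cupDualH N X₂.O X₂.HA X₂.qHA))
    (c : groupCohomology.H1 (Rep.ofMulDistribMulAction X₁.HA (Mu N X₁.O))) :
    (f.thm24Data N).recTargetMap ((X₁.dualityIsoOfLocalDuality N e₁ h₁ hH₁).toAddEquiv c) =
      (X₂.dualityIsoOfLocalDuality N e₂ h₂ hH₂).toAddEquiv (f.isoH1 N c) :=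
  f.recTargetMap_dualityIsoOfCupProduct N _ _ _ _ c

end Def22Context

end PadicKummer

end Literature.AlgebraicGeometry.Frobenioids
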